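import Summits.BirchSwinnertonDyer.BirchSwinnertonDyer.Theorems.PublishedInputsGreenbergKerGCountOfCassels
import Summits.BirchSwinnertonDyer.BirchSwinnertonDyer.Theorems.ByReductionTypeAtTwoSupersingularFlatLiftAssemblyTop
import HarnessLib

set_option linter.dupNamespace false -- `…BirchSwinnertonDyer.BirchSwinnertonDyer…` is the cell's nested layout (D-0017)
set_option autoImplicit false

/-!
# Greenberg LNM 1716 Lemma 4.7 WITH RATIONAL `p`-TORSION, part 1: the evaluation embedding `ker g₀ ↪ ∏_{v ∈ S} 𝒦_{v,0}[p^∞]`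
# and its range criterion at an auxiliary place `v₀` (no hypothesis on `E(K)[p]`)

Cell `bsd-2adic` (run/shared/lean/pub/bsd-2adic/), seat `bsd-2adic-tower-1` GEN 31; `--supports stmt-BirchSwinnertonDyer-19271`
(helper). THEOREMS ONLY (no definition, no named fact, no `sorry`); closes no item; nothing booked; BSD is not proved by any of this.

R. Greenberg, *Iwasawa theory for elliptic curves*, LNM 1716 (1999), §4 Lemma 4.7 (pp. 107–108): `|ker g| = |ker r|·
|(Sel_E(F_∞)_p)_Γ| / |E(F)_p|`, through the snake `0 → ker g → ker r → ker t → 0` over `𝒫_E^Σ(F)/𝒢_E^Σ(F) ≅ E(F)_p^`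
(Cassels, p. 104). The tree renders `ker g₀` as `A₀/Sel₀` (`WeierstrassCurve.KerG κ 0`, `A₀ = h₀⁻¹(Sel_∞)`) and `ker r_v` as
`𝒦_{v,0}[p^∞]` (`WeierstrassCurve.localTowerKerPrimary κ K_v 0`). Seat bsd-inputs-k4-p1 (gen 4,
`InputsGreenbergKerG.natCard_kerG_zero_eq_prod`) proved `#ker g₀ = ∏_{v∈S} #𝒦_{v,0}[p^∞]` under `E(K)[p^∞]^{Γ_K} = 0`, the
torsion hypothesis entering ONLY through Cassels' surjectivity. This file keeps the torsion-free HALF of that proof and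
replaces the other half by a CRITERION at an auxiliary good place `v₀ ∉ S` (`v₀ ∤ p`), which is what the torsion-tolerant
count of part 2 consumes (there Cassels' surjectivity AWAY FROM `v₀` — `InputsGreenbergCasselsTorsion.casselsSurjectivity_H1Sigma_eraseOne`,
k4-p1 gen 7, NO torsion hypothesis — produces the global classes, and the local class left over at `v₀` is the defect):

* `exists_kerG_embedding` — for a number field `K`, `W/K` elliptic, a prime `p`, the CYCLOTOMIC `ℤ_p`-extension `κ`, a finite
  `S ⊇ {bad places} ∪ {v ∣ p}` and `v₀ ∉ S`: there is an INJECTIVE homomorphism `Ψ : A₀/Sel₀ →+ ∏_{v ∈ S} 𝒦_{v,0}[p^∞]`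
  (evaluation of the local classes, kernel `Sel₀` by `mem_selmerLayer_of_forall_localResOver_conjH1_eq_zero`) whose range
  contains the local vector of EVERY class `Y ∈ H¹(Γ_K, E[p^∞])` that is unramified outside `S ∪ {v₀}`, dies over `K_∞` at
  the places of `S`, VANISHES at `v₀`, and vanishes at the infinite places (such a `Y` restricts into `A₀`: at `S` by
  hypothesis, at `v₀` and `∞` because its local class is already `0` over `K`, elsewhere because unramified classes are
  Kummer over the cyclotomic tower — `GreenbergVatsalUnramifiedAway.unramKer_le_localKerOver_of_isCyclotomic`).
* `natCard_pi_localTowerKerPrimary_eq_natCard_kerG_mul` — bookkeeping: `∏_{v∈S} #𝒦_{v,0}[p^∞] = #ker g₀ · [∏ 𝒦 : Ψ(ker g₀)]`.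

HONEST FRAMING: a re-cut of a kernel-checked proof of the K4 line (no torsion hypothesis is used or removed here; the place
`v₀` is where part 2 measures the cokernel `E(K)_p^`). Closes no item; no summit statement is proved; the
Birch–Swinnerton-Dyer conjecture is NOT proved by any of this.

References: [GreenbergLNM1716] §3 p. 90, §4 p. 104, Lemma 4.7 (pp. 107–108), Prop. 4.13 (p. 122); [GreenbergVatsal2000]
§2 pp. 16–17.
-/

noncomputable section

open scoped Classical NumberField

open NumberField IsDedekindDomain Field

namespace Summit.BirchSwinnertonDyer.BirchSwinnertonDyer.Theorems.TorsionEulerChar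

open Literature.NumberTheory.EllipticCurves Literature.NumberTheory.GaloisRepresentations
  WeierstrassCurve ZpExtension Literature.NumberTheory.EllipticCurves.IwasawaAlgebra
  Literature.NumberTheory.EllipticCurves.IwasawaDual
  Literature.NumberTheory.EllipticCurves.GreenbergVatsal2000 Literature.NumberTheory.EllipticCurves.GreenbergSelmer
  Literature.NumberTheory.EllipticCurves.Rank1Residual Summit.BirchSwinnertonDyer.Rank1Residual.X2

variable {K : Type} [Field K] [NumberField K] (W : WeierstrassCurve K) [W.IsElliptic] (p : ℕ) [hp : Fact p.Prime]
  (κ : ZpExtension K p)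

/-! ## §1 The evaluation embedding `A₀/Sel₀ ↪ ∏_{v ∈ S} 𝒦_{v,0}[p^∞]` and its range criterion at `v₀` -/

set_option maxHeartbeats 400000 in
/-- **Greenberg LNM 1716 Lemma 4.7, the map `ker g₀ → ker r₀` with NO torsion hypothesis.** For `W/K` elliptic over a number
field, `κ` the CYCLOTOMIC `ℤ_p`-extension, `S` a finite set of finite places off which `E` has good reduction and `v ∤ p`, and an
auxiliary place `v₀ ∉ S`: there is an injective homomorphism `Ψ : A₀/Sel₀ →+ ∏_{v ∈ S} 𝒦_{v,0}[p^∞]` (`y ↦ (loc_v y)_v`) such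
that for every `Y ∈ H¹(Γ_K, E[p^∞])` unramified outside `S ∪ {v₀}` whose local classes die over `K_∞` at the places of `S`
and VANISH at `v₀` and at the infinite places, the vector `(loc_v Y)_{v ∈ S}` (read in `∏ 𝒦_{v,0}[p^∞]`) lies in the range of
`Ψ`. (k4-p1's `natCard_kerG_zero_eq_prod`, surjectivity half replaced by this criterion; `v₀` is where the torsion defect of
Cassels' theorem will be measured.) [cite: GreenbergLNM1716, §3 p. 90, §4 Lemma 4.7 (pp. 107–108)]
[cite: GreenbergVatsal2000, §2 pp. 16–17] -/
theorem exists_kerG_embedding (hκ : κ.IsCyclotomic) (S : Finset (HeightOneSpectrum (𝓞 K)))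
    (hS : ∀ v ∉ S, ((p : ℕ) : 𝓞 K) ∉ v.asIdeal ∧ W.HasGoodReductionAt v)
    (v₀ : HeightOneSpectrum (𝓞 K)) (hv₀ : v₀ ∉ S) :
    ∃ Ψ : W.KerG κ 0 →+ (∀ v : S, W.localTowerKerPrimary κ (v.1.adicCompletion K) 0),
      Function.Injective Ψ ∧
      ∀ Y : W.subgroupH1 p (⊤ : Subgroup (absoluteGaloisGroup K)),
        Y ∈ unramifiedOutside (⊤ : Subgroup (absoluteGaloisGroup K)) (W.geomPrimaryTorsion p) p
            ((↑S : Set (HeightOneSpectrum (𝓞 K))) ∪ {v₀}) →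
        (∀ v ∈ S, Literature.NumberTheory.EllipticCurves.resOfLe (localPoints W (v.adicCompletion K))
            (Subgroup.comap_mono le_top :
              localSubgroup κ.kerSubgroup (v.adicCompletion K) ≤
                localSubgroup (⊤ : Subgroup (absoluteGaloisGroup K)) (v.adicCompletion K))
            (W.localResOver p ⊤ (v.adicCompletion K) Y) = 0) →
        W.localResOver p ⊤ (v₀.adicCompletion K) Y = 0 →
        (∀ w : InfinitePlace K, W.localResOver p ⊤ w.Completion Y = 0) →
        ∃ q : W.KerG κ 0, ∀ v : S,
          ((Ψ q v : W.localTowerKerPrimary κ (v.1.adicCompletion K) 0) :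
              discreteH1 (localSubgroup (κ.layerSubgroup 0) (v.1.adicCompletion K)) (localPoints W (v.1.adicCompletion K))) =
            Literature.NumberTheory.EllipticCurves.resOfLe (localPoints W (v.1.adicCompletion K))
              (Subgroup.comap_mono le_top :
                localSubgroup (κ.layerSubgroup 0) (v.1.adicCompletion K) ≤
                  localSubgroup (⊤ : Subgroup (absoluteGaloisGroup K)) (v.1.adicCompletion K))
              (W.localResOver p ⊤ (v.1.adicCompletion K) Y) := by
  -- adapted from `InputsGreenbergKerG.natCard_kerG_zero_eq_prod` (bsd-inputs-k4-p1 gen 4)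
  -- notation
  let A : AddSubgroup (W.subgroupH1 p (κ.layerSubgroup 0)) := W.selmerInftyPreimage κ 0
  let Sel₀ : AddSubgroup (W.subgroupH1 p (κ.layerSubgroup 0)) := W.selmerLayer κ 0
  let T : HeightOneSpectrum (𝓞 K) → Type := fun v ↦ W.localTowerKerPrimary κ (v.adicCompletion K) 0
  let loc : ∀ v : HeightOneSpectrum (𝓞 K), W.subgroupH1 p (κ.layerSubgroup 0) →+
      discreteH1 (localSubgroup (κ.layerSubgroup 0) (v.adicCompletion K)) (localPoints W (v.adicCompletion K)) :=
    fun v ↦ W.localResOver p (κ.layerSubgroup 0) (v.adicCompletion K)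
  have hone : ∀ y : W.subgroupH1 p (κ.layerSubgroup 0), W.conjH1 p (κ.layerSubgroup 0) 1 y = y := fun y ↦ by
    rw [W.conjH1_one_holds p (κ.layerSubgroup 0), AddMonoidHom.id_apply]
  -- `loc_v y ∈ 𝒦_{v,0}[p^∞]` for `y ∈ A₀`
  have hmemT : ∀ (y : W.subgroupH1 p (κ.layerSubgroup 0)), y ∈ A → ∀ v, loc v y ∈ W.localTowerKerPrimary κ (v.adicCompletion K) 0 := by
    intro y hy v
    obtain ⟨k, hk⟩ := W.exists_pow_smul_subgroupH1_layer_eq_zero κ 0 y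
    refine (W.mem_localTowerKerPrimary_iff κ _ 0 _).mpr ⟨?_, k, by rw [← map_nsmul, hk, map_zero]⟩
    have h := W.localResOver_conjH1_mem_localTowerKer_of_mem κ hy v 1
    rwa [hone] at h
  -- the evaluation map `Φ : A₀ → ∏_{v ∈ S} 𝒦_{v,0}[p^∞]`
  let Φ : A →+ (∀ v : S, T v) :=
    { toFun := fun y v ↦ ⟨loc v y, hmemT y y.2 v⟩
      map_zero' := funext fun v ↦ Subtype.ext (by simp)
      map_add' := fun y y' ↦ funext fun v ↦ Subtype.ext (by simp) }
  have hΦ : ∀ (y : A) (v : S), ((Φ y v : T v) : _) = loc v y := fun _ _ ↦ rfl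
  -- `ker Φ = Sel₀`
  have h0 : ∀ v ∉ S, W.localTowerKerPrimary κ (v.adicCompletion K) 0 = ⊥ := fun v hv ↦
    Greenberg1999.localTowerKerPrimary_eq_bot_of_hasGoodReductionAt W κ (hS v hv).1 (hS v hv).2 0
  have hker : ∀ y : A, Φ y = 0 ↔ (y : W.subgroupH1 p (κ.layerSubgroup 0)) ∈ Sel₀ := by
    intro y
    constructor
    · intro hy0
      refine W.mem_selmerLayer_of_forall_localResOver_conjH1_eq_zero κ S h0 (fun _ ↦ {1}) (fun v _ σ ↦ ?_) y.2 ?_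
      · refine ⟨1, Finset.mem_singleton_self _, 1, σ, ?_, by rw [map_one, one_mul, one_mul]⟩
        rw [ZpExtension.layerSubgroup_zero]; exact Subgroup.mem_top σ
      · intro v hv ρ hρ
        rw [Finset.mem_singleton] at hρ
        rw [hρ, hone]
        have h : ((Φ y ⟨v, hv⟩ : T v) : discreteH1 (localSubgroup (κ.layerSubgroup 0) (v.adicCompletion K))
            (localPoints W (v.adicCompletion K))) = 0 := by
          rw [hy0]; rfl
        rw [hΦ] at h
        exact h
    · intro hy
      funext v
      apply Subtype.ext
      rw [hΦ]
      change loc v y = 0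
      have h := ((W.mem_selmerGroupOver_iff p (κ.layerSubgroup 0) _).mp hy).1 v 1
      rwa [hone, mem_localKerOver_iff] at h
  -- the induced map on `A₀/Sel₀` is injective
  have hle : Sel₀.addSubgroupOf A ≤ Φ.ker := fun y hy ↦ (AddMonoidHom.mem_ker).mpr ((hker y).mpr hy)
  let Ψ : W.KerG κ 0 →+ (∀ v : S, T v) := QuotientAddGroup.lift (Sel₀.addSubgroupOf A) Φ hle
  have hΨmk : ∀ y : A, Ψ (y : W.KerG κ 0) = Φ y := fun y ↦ QuotientAddGroup.lift_mk _ hle y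
  have hinj : Function.Injective Ψ := by
    refine (injective_iff_map_eq_zero Ψ).mpr fun q hq ↦ ?_
    induction q using QuotientAddGroup.induction_on with
    | H y =>
      rw [hΨmk] at hq
      exact (QuotientAddGroup.eq_zero_iff y).mpr ((hker y).mp hq)
  refine ⟨Ψ, hinj, fun Y hYH hYS hY₀ hYinf ↦ ?_⟩
  -- `y₀ = res Y ∈ H¹(K_0, E[p^∞])` and its image in `H¹(K_∞, E[p^∞])`
  let y₀ : W.subgroupH1 p (κ.layerSubgroup 0) := W.resOfLe p (le_top : κ.layerSubgroup 0 ≤ ⊤) Y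
  have hh : W.layerToInfty κ 0 y₀ = W.resOfLe p (le_top : κ.kerSubgroup ≤ ⊤) Y := by
    change (W.resOfLe p (κ.kerSubgroup_le_layerSubgroup 0)) (W.resOfLe p (le_top : κ.layerSubgroup 0 ≤ ⊤) Y) = _
    rw [← AddMonoidHom.comp_apply, W.resOfLe_comp_holds p]
  -- the local restrictions of `res Y` over `K_∞` vanish at `v ∈ S`, at `v₀` and at `∞`
  have hlocS : ∀ v ∈ S, W.resOfLe p (le_top : κ.kerSubgroup ≤ ⊤) Y ∈ W.localKerOver p κ.kerSubgroup (v.adicCompletion K) := by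
    intro v hv
    rw [mem_localKerOver_iff]
    change W.localResOverOfEmb p κ.kerSubgroup (closureEmb (K := K) (v.adicCompletion K)) _ = 0
    rw [W.localResOverOfEmb_resOfLe p (closureEmb (K := K) (v.adicCompletion K)) (le_top : κ.kerSubgroup ≤ ⊤) Y]
    exact hYS v hv
  have hloc₀ : W.resOfLe p (le_top : κ.kerSubgroup ≤ ⊤) Y ∈ W.localKerOver p κ.kerSubgroup (v₀.adicCompletion K) :=
    SSFlatEC.resOfLe_top_mem_localKerOver_of_localResOver_eq_zero W κ Y hY₀
  have hlocinf : ∀ w : InfinitePlace K,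
      W.resOfLe p (le_top : κ.kerSubgroup ≤ ⊤) Y ∈ W.localKerOver p κ.kerSubgroup w.Completion := fun w ↦
    SSFlatEC.resOfLe_top_mem_localKerOver_of_localResOver_eq_zero W κ Y (hYinf w)
  -- hence `res Y ∈ Sel_{p^∞}(E/K_∞)`, i.e. `y₀ ∈ A₀`
  have hy₀ : y₀ ∈ A := by
    rw [W.mem_selmerInftyPreimage_iff κ 0, hh]
    change W.resOfLe p (le_top : κ.kerSubgroup ≤ ⊤) Y ∈ W.selmerGroupOver p κ.kerSubgroup
    have hyH' : W.resOfLe p (le_top : κ.kerSubgroup ≤ ⊤) Y ∈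
        unramifiedOutside κ.kerSubgroup (W.geomPrimaryTorsion p) p ((↑S : Set (HeightOneSpectrum (𝓞 K))) ∪ {v₀}) :=
      SSFlatEC.resOfLe_mem_unramifiedOutside (W.geomPrimaryTorsion p) (le_top : κ.kerSubgroup ≤ ⊤) p _ hYH
    have honeK : ∀ {B : AddSubgroup (W.subgroupH1 p κ.kerSubgroup)} {z : W.subgroupH1 p κ.kerSubgroup},
        W.conjH1 p κ.kerSubgroup 1 z ∈ B → z ∈ B := fun {B z} h ↦ by
      rwa [W.conjH1_one_holds p κ.kerSubgroup, AddMonoidHom.id_apply] at h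
    refine (W.mem_selmerGroupOver_iff p κ.kerSubgroup _).mpr ⟨fun v σ ↦ ?_, fun w σ ↦ ?_⟩
    · rw [SSFlatEC.conjH1_resOfLe_top W κ σ Y]
      by_cases hv : v ∈ S
      · exact hlocS v hv
      · by_cases hvv₀ : v = v₀
        · subst hvv₀; exact hloc₀
        · have hvS' : v ∉ ((↑S : Set (HeightOneSpectrum (𝓞 K))) ∪ {v₀}) := by
            rintro (h | h)
            · exact hv (Finset.mem_coe.mp h)
            · exact hvv₀ (Set.mem_singleton_iff.mp h)
          exact GreenbergVatsalUnramifiedAway.unramKer_le_localKerOver_of_isCyclotomic (κ := κ) (v := v) (W := W)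
            (p := p) hκ (hS v hv).2 (hS v hv).1
            (honeK ((mem_unramifiedOutside_iff _).mp hyH' v hvS' (hS v hv).1 1))
    · rw [SSFlatEC.conjH1_resOfLe_top W κ σ Y]
      exact hlocinf w
  -- and `Ψ y₀` is the local vector of `Y`
  refine ⟨((⟨y₀, hy₀⟩ : A) : W.KerG κ 0), fun v ↦ ?_⟩
  rw [hΨmk, hΦ]
  change W.localResOverOfEmb p (κ.layerSubgroup 0) (closureEmb (K := K) (v.1.adicCompletion K)) y₀ = _
  rw [W.localResOverOfEmb_resOfLe p (closureEmb (K := K) (v.1.adicCompletion K)) (le_top : κ.layerSubgroup 0 ≤ ⊤) Y]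
  rfl

/-! ## §2 Bookkeeping: `∏ #𝒦_{v,0}[p^∞] = #ker g₀ · [∏ 𝒦 : Ψ(ker g₀)]` -/

omit [W.IsElliptic] in
/-- For an injective `Ψ : ker g₀ →+ ∏_{v ∈ S} 𝒦_{v,0}[p^∞]`: `∏_{v ∈ S} #𝒦_{v,0}[p^∞] = #ker g₀ · #((∏ 𝒦)/Ψ(ker g₀))`
(Lagrange). Bookkeeping for part 2. [folklore] -/
theorem prod_natCard_localTowerKerPrimary_eq_natCard_kerG_mul (S : Finset (HeightOneSpectrum (𝓞 K)))
    (Ψ : W.KerG κ 0 →+ (∀ v : S, W.localTowerKerPrimary κ (v.1.adicCompletion K) 0)) (hΨ : Function.Injective Ψ) :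
    ∏ v ∈ S, Nat.card (W.localTowerKerPrimary κ (v.adicCompletion K) 0) =
      Nat.card (W.KerG κ 0) * Nat.card ((∀ v : S, W.localTowerKerPrimary κ (v.1.adicCompletion K) 0) ⧸ Ψ.range) := by
  rw [← Finset.prod_coe_sort S (fun v ↦ Nat.card (W.localTowerKerPrimary κ (v.adicCompletion K) 0)), ← Nat.card_pi,
    Ψ.range.card_eq_card_quotient_mul_card_addSubgroup, mul_comm,
    Nat.card_congr (Ψ.ofInjective hΨ).toEquiv.symm]

end Summit.BirchSwinnertonDyer.BirchSwinnertonDyer.Theorems.TorsionEulerChar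

end
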